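import Summits.Schanuel.Schanuel.Theses.RoyCriterion
import Literature.NumberTheory.Transcendental.PeriodsWave0NesterenkoProofs
import Literature.NumberTheory.Transcendental.SchanuelEclEmptyProofs
import Literature.Barriers.Schanuel.NesterenkoModularScopeConjectureProofs
import Literature.Barriers.Schanuel.LargeTranscendenceDegree

-- `Summit.Schanuel.Schanuel.…` is the mandated layout of this single-problem summit (CONVENTIONS §1).
set_option linter.dupNamespace false

/-!
# Route `RoyCriterion`, crux `SchanuelTwo` (stmt-Schanuel-0069), line `CardA_BW` — stub
# `stub_nesterenkoPlanes`: the `ℚ`-planes through `π` or `π√3` (Nesterenko 1996)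

The crux is Schanuel's conjecture for `n = 2`: for `x : Fin 2 → ℂ` linearly independent over `ℚ`,
`2 ≤ trdeg_ℚ K_x` where `K_x = ℚ(x 0, x 1, e^{x 0}, e^{x 1})
= IntermediateField.adjoin ℚ (range x ∪ range (exp ∘ x))`. Line `CardA_BW` (idea
`bw-log-rich-planes`) is a sector atlas for the crux; this file is the NESTERENKO-PLANES sector:
if the `ℚ`-plane `span_ℚ(x 0, x 1) ⊂ ℂ` contains `π` (resp. `π√3`), then `2 ≤ trdeg_ℚ K_x` — with
NO linear-independence hypothesis.

Mechanism. For `y ∈ span_ℚ(x)` some multiple `N • y` (`N ≥ 1`) lies in the `ℤ`-span of `x`, so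
`N • y ∈ K_x` and `e^{N y} ∈ K_x` (a monomial in the `e^{± x i}`); hence `y ∈ K_x` and `e^y` is a
root of `X^N − e^{Ny} ∈ K_x[X]` (`mem_SF_and_isAlgebraic_exp_of_mem_span`). Consequently
`trdeg_ℚ K_x` is monotone in the plane `span_ℚ(x)` and is an invariant of it
(`trdeg_SF_le_of_span_le`, `trdeg_SF_eq_of_span_eq`: the crux lives on the Grassmannian of
`ℚ`-planes of `ℂ`, `GL₂(ℚ)`-invariantly). If `π ∈ span_ℚ(x)` then `π ∈ K_x` and `e^π` is algebraic
over `K_x`, and `{π, e^π}` is algebraically independent over `ℚ` — the first two coordinates of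
Nesterenko's triple `(π, e^π, Γ(1/4))` (Nesterenko 1996; LNM 1752 Ch. 3 Corollary 1.2), PROVED in
the tree as `Literature.NumberTheory.Transcendental.nesterenko_holds`; adjoining `{π, e^π}` to `K_x`
does not change `trdeg` (tree lemma
`Literature.Barriers.Schanuel.trdeg_adjoin_union_eq_of_isAlgebraic_adjoin`), so `2 ≤ trdeg_ℚ K_x`
(`schanuelTwo_of_pi_mem_span`). If `π√3 ∈ span_ℚ(x)` then `π` is a root of `3X² − (π√3)²` over
`K_x`, `e^{π√3}` is algebraic over `K_x`, and `{π, e^{π√3}}` is algebraically independent —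
Nesterenko at `τ = ρ` (LNM 1752 Ch. 1 §3 Corollary 3.2, `D = 3`), PROVED in the tree as
`Literature.NumberTheory.Transcendental.nesterenko'_holds` (`schanuelTwo_of_pi_mul_sqrt_three_mem_span`;
e.g. the pair `(iπ, π√3)`, `schanuelTwo_at_piI_pi_mul_sqrt_three`). The stub
`stub_nesterenkoPlanes` is the disjunction of the two plane theorems, verbatim as registered in the
lead's skeleton of line `CardA_BW`.

Provenance: ported def-free (the Schanuel field `SF x` written out as
`IntermediateField.adjoin ℚ (Set.range x ∪ Set.range (Complex.exp ∘ x))`) from §0, §2 and §9 of the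
crux work file `Cruxes/SchanuelTwo/Disproof.lean` (session refuter-cdisprove-stmt-Schanuel-0069-0,
namespace `Summit.Schanuel.Schanuel.Cruxes.SchanuelTwo.Disproof`), whose kernel-checked positive
instances cannot be landed from a refuter seat. No definitions, no sorry; axioms `propext`,
`Classical.choice`, `Quot.sound`.

## References

* [NesterenkoPhilippon2001] Yu. V. Nesterenko, P. Philippon (eds.), *Introduction to Algebraic
  Independence Theory*, Lecture Notes in Math. 1752, Springer 2001: Ch. 3 §1 Corollary 1.2;
  Ch. 1 §3 Corollary 3.2 and Remark (ii).
* [Nesterenko1996SbMath] Yu. V. Nesterenko, *Modular functions and transcendence questions*,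
  Sb. Math. 187 (1996), 1319–1348.
-/

noncomputable section

open Complex IntermediateField

namespace Summit.Schanuel.Schanuel.Theorems

/-! ### Bookkeeping -/

/-- An algebraically independent pair of complex numbers lying in an intermediate field `L` forces
`2 ≤ trdeg_ℚ L`: pull the pair back along the injective inclusion `L → ℂ`
(`AlgebraicIndependent.of_comp`) and count (`#(Fin 2) ≤ trdeg`). [folklore] -/
theorem two_le_trdeg_of_algebraicIndependent {L : IntermediateField ℚ ℂ} {v : Fin 2 → ℂ}
    (hv : AlgebraicIndependent ℚ v) (hmem : ∀ i, v i ∈ L) :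
    (2 : Cardinal) ≤ Algebra.trdeg ℚ L := by
  let y : Fin 2 → L := fun i => ⟨v i, hmem i⟩
  have hy : AlgebraicIndependent ℚ y := AlgebraicIndependent.of_comp L.val hv
  simpa using hy.cardinalMk_le_trdeg

/-- `π` and `e^π` are algebraically independent over `ℚ` (as complex numbers): the first two
coordinates of Nesterenko's triple `(π, e^π, Γ(1/4))`, PROVED in the tree
(`Literature.NumberTheory.Transcendental.nesterenko_holds`), transported along `ℝ → ℂ`.
[cite: NesterenkoPhilippon2001, Ch. 3 Corollary 1.2] -/
theorem algebraicIndependent_pi_exp_pi :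
    AlgebraicIndependent ℚ ![(Real.pi : ℂ), ((Real.exp Real.pi : ℝ) : ℂ)] := by
  have hN := Literature.NumberTheory.Transcendental.nesterenko_holds
  have h2 : AlgebraicIndependent ℚ ![Real.pi, Real.exp Real.pi] := by
    have h := hN.comp ![(0 : Fin 3), 1] (by decide)
    convert h using 1
    funext i; fin_cases i <;> rfl
  have e : (![(Real.pi : ℂ), ((Real.exp Real.pi : ℝ) : ℂ)] : Fin 2 → ℂ) =
      (Complex.ofRealAm.restrictScalars ℚ) ∘ ![Real.pi, Real.exp Real.pi] := by
    funext i; fin_cases i <;> simp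
  rw [e]
  exact h2.map' Complex.ofReal_injective

/-- `π` and `e^{π√3}` are algebraically independent over `ℚ` (as complex numbers): the first two
coordinates of Nesterenko's triple `(π, e^{π√3}, Γ(1/3))` at `τ = ρ`, PROVED in the tree
(`Literature.NumberTheory.Transcendental.nesterenko'_holds`), transported along `ℝ → ℂ`.
[cite: NesterenkoPhilippon2001, Ch. 1 §3 Corollary 3.2] -/
theorem algebraicIndependent_pi_exp_pi_mul_sqrt_three :
    AlgebraicIndependent ℚ ![(Real.pi : ℂ), ((Real.exp (Real.pi * Real.sqrt 3) : ℝ) : ℂ)] := by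
  have hN := Literature.NumberTheory.Transcendental.nesterenko'_holds
  have h2 : AlgebraicIndependent ℚ ![Real.pi, Real.exp (Real.pi * Real.sqrt 3)] := by
    have h := hN.comp ![(0 : Fin 3), 1] (by decide)
    convert h using 1
    funext i; fin_cases i <;> rfl
  have e : (![(Real.pi : ℂ), ((Real.exp (Real.pi * Real.sqrt 3) : ℝ) : ℂ)] : Fin 2 → ℂ) =
      (Complex.ofRealAm.restrictScalars ℚ) ∘ ![Real.pi, Real.exp (Real.pi * Real.sqrt 3)] := by
    funext i; fin_cases i <;> simp
  rw [e]
  exact h2.map' Complex.ofReal_injective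

/-! ### The crux depends only on the `ℚ`-plane `span_ℚ(x)` -/

/-- **Two algebraically independent numbers algebraic over `K_x = ℚ(x, e^x)` settle the crux at
`x`**: adjoining them does not change `trdeg` (relative algebraic adjunction,
`Literature.Barriers.Schanuel.trdeg_adjoin_union_eq_of_isAlgebraic_adjoin`), and the enlarged field
visibly contains an algebraically independent pair. [folklore] -/
theorem two_le_trdeg_SF_of_isAlgebraic_pair (x : Fin 2 → ℂ) {u v : ℂ}
    (huv : AlgebraicIndependent ℚ ![u, v])
    (hu : IsAlgebraic ↥(IntermediateField.adjoin ℚ (Set.range x ∪ Set.range (Complex.exp ∘ x))) u)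
    (hv : IsAlgebraic ↥(IntermediateField.adjoin ℚ (Set.range x ∪ Set.range (Complex.exp ∘ x))) v) :
    (2 : Cardinal) ≤ Algebra.trdeg ℚ
      ↥(IntermediateField.adjoin ℚ (Set.range x ∪ Set.range (Complex.exp ∘ x))) := by
  have hT : ∀ z ∈ ({u, v} : Set ℂ),
      IsAlgebraic ↥(adjoin ℚ (Set.range x ∪ Set.range (Complex.exp ∘ x))) z := by
    rintro z (rfl | hz)
    · exact hu
    · rw [Set.mem_singleton_iff.mp hz]; exact hv
  have heq := Literature.Barriers.Schanuel.trdeg_adjoin_union_eq_of_isAlgebraic_adjoin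
    (Set.range x ∪ Set.range (Complex.exp ∘ x)) {u, v} hT
  have h2 : (2 : Cardinal) ≤ Algebra.trdeg ℚ
      ↥(adjoin ℚ (Set.range x ∪ Set.range (Complex.exp ∘ x) ∪ {u, v})) := by
    refine two_le_trdeg_of_algebraicIndependent huv ?_
    intro i
    fin_cases i
    · exact subset_adjoin ℚ _ (Or.inr (Set.mem_insert _ _))
    · exact subset_adjoin ℚ _ (Or.inr (Set.mem_insert_of_mem _ (Set.mem_singleton _)))
  exact h2.trans_eq heq

/-- **Elements of the `ℚ`-plane**: for `y ∈ span_ℚ(x)`, `y ∈ K_x = ℚ(x, e^x)` and `e^y` is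
algebraic over `K_x` — for a denominator `N ≥ 1` of `y`, `N • y` lies in the `ℤ`-span of `x`, so
`N • y ∈ K_x`, `e^{Ny} ∈ K_x`, and `e^y` is a root of `X^N − e^{Ny} ∈ K_x[X]`. [folklore] -/
theorem mem_SF_and_isAlgebraic_exp_of_mem_span (x : Fin 2 → ℂ) {y : ℂ}
    (hy : y ∈ Submodule.span ℚ (Set.range x)) :
    y ∈ IntermediateField.adjoin ℚ (Set.range x ∪ Set.range (Complex.exp ∘ x)) ∧
      IsAlgebraic ↥(IntermediateField.adjoin ℚ (Set.range x ∪ Set.range (Complex.exp ∘ x)))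
        (Complex.exp y) := by
  obtain ⟨N, hN, hmem⟩ := Literature.NumberTheory.Transcendental.exists_nsmul_mem_span_int x hy
  obtain ⟨hNy, hexpNy⟩ := Literature.NumberTheory.Transcendental.mem_adjoin_of_mem_span_int x hmem
  have hNq : (N : ℚ) ≠ 0 := Nat.cast_ne_zero.mpr hN
  constructor
  · have hy' : y = ((N : ℚ)⁻¹ : ℚ) • ((N : ℚ) • y) := by
      rw [smul_smul, inv_mul_cancel₀ hNq, one_smul]
    rw [hy', Rat.smul_def]
    exact mul_mem
      (SubfieldClass.ratCast_mem (adjoin ℚ (Set.range x ∪ Set.range (Complex.exp ∘ x))) _) hNy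
  · have hpow : cexp y ^ N = cexp ((N : ℚ) • y) := by
      rw [Rat.smul_def, Rat.cast_natCast, Complex.exp_nat_mul]
    refine ⟨Polynomial.X ^ N - Polynomial.C ⟨cexp ((N : ℚ) • y), hexpNy⟩, ?_, ?_⟩
    · exact Polynomial.X_pow_sub_C_ne_zero (Nat.pos_of_ne_zero hN) _
    · simp only [map_sub, map_pow, Polynomial.aeval_X, Polynomial.aeval_C,
        IntermediateField.algebraMap_apply]
      rw [hpow]
      exact sub_self _

/-- **`trdeg_ℚ ℚ(x, e^x)` is monotone in the `ℚ`-plane `span_ℚ(x)`**: if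
`span_ℚ(x') ≤ span_ℚ(x)` then every generator of `ℚ(x', e^{x'})` is algebraic over `ℚ(x, e^x)`
(`mem_SF_and_isAlgebraic_exp_of_mem_span`), so `ℚ(x', e^{x'}) ≤ ℚ(x, e^x)(x', e^{x'})`, a field of
the same transcendence degree as `ℚ(x, e^x)`. [folklore] -/
theorem trdeg_SF_le_of_span_le {x x' : Fin 2 → ℂ}
    (h : Submodule.span ℚ (Set.range x') ≤ Submodule.span ℚ (Set.range x)) :
    Algebra.trdeg ℚ ↥(IntermediateField.adjoin ℚ (Set.range x' ∪ Set.range (Complex.exp ∘ x'))) ≤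
      Algebra.trdeg ℚ ↥(IntermediateField.adjoin ℚ (Set.range x ∪ Set.range (Complex.exp ∘ x))) := by
  have hT : ∀ z ∈ Set.range x' ∪ Set.range (Complex.exp ∘ x'),
      IsAlgebraic ↥(adjoin ℚ (Set.range x ∪ Set.range (Complex.exp ∘ x))) z := by
    rintro z (⟨i, rfl⟩ | ⟨i, rfl⟩)
    · have hm := (mem_SF_and_isAlgebraic_exp_of_mem_span x
        (h (Submodule.subset_span ⟨i, rfl⟩))).1
      exact isAlgebraic_algebraMap
        (⟨x' i, hm⟩ : ↥(adjoin ℚ (Set.range x ∪ Set.range (Complex.exp ∘ x))))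
    · exact (mem_SF_and_isAlgebraic_exp_of_mem_span x (h (Submodule.subset_span ⟨i, rfl⟩))).2
  have heq := Literature.Barriers.Schanuel.trdeg_adjoin_union_eq_of_isAlgebraic_adjoin
    (Set.range x ∪ Set.range (Complex.exp ∘ x)) (Set.range x' ∪ Set.range (Complex.exp ∘ x')) hT
  have hle : adjoin ℚ (Set.range x' ∪ Set.range (Complex.exp ∘ x')) ≤
      adjoin ℚ (Set.range x ∪ Set.range (Complex.exp ∘ x) ∪
        (Set.range x' ∪ Set.range (Complex.exp ∘ x'))) :=
    adjoin.mono ℚ _ _ Set.subset_union_right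
  exact (Literature.Barriers.Schanuel.trdeg_mono hle).trans_eq heq

/-- **The crux is an invariant of the `ℚ`-plane `span_ℚ(x)`** (in particular it is
`GL₂(ℚ)`-invariant: `trdeg_ℚ ℚ(x, e^x)` is a function on the Grassmannian of `ℚ`-planes of `ℂ`,
Zilber's predimension of the plane up to the shift by `dim`). [folklore] -/
theorem trdeg_SF_eq_of_span_eq {x x' : Fin 2 → ℂ}
    (h : Submodule.span ℚ (Set.range x) = Submodule.span ℚ (Set.range x')) :
    Algebra.trdeg ℚ ↥(IntermediateField.adjoin ℚ (Set.range x ∪ Set.range (Complex.exp ∘ x))) =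
      Algebra.trdeg ℚ ↥(IntermediateField.adjoin ℚ (Set.range x' ∪ Set.range (Complex.exp ∘ x'))) :=
  le_antisymm (trdeg_SF_le_of_span_le h.le) (trdeg_SF_le_of_span_le h.ge)

/-! ### Planes through `π` or `π√3` are settled (Nesterenko at `τ = i`, `τ = ρ`) -/

/-- **Every `ℚ`-plane through `π` satisfies the crux** (`π ∈ ℚ(x, e^x)`, `e^π` algebraic over it,
`{π, e^π}` algebraically independent — Nesterenko at `τ = i`): e.g. `x = (π + log 2, π − log 2)`,
`(3π/2 + e, e)`, `(iπ, π)`. No linear independence needed.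
[cite: NesterenkoPhilippon2001, Ch. 3 Corollary 1.2] -/
theorem schanuelTwo_of_pi_mem_span (x : Fin 2 → ℂ)
    (hpi : (Real.pi : ℂ) ∈ Submodule.span ℚ (Set.range x)) :
    (2 : Cardinal) ≤ Algebra.trdeg ℚ
      ↥(IntermediateField.adjoin ℚ (Set.range x ∪ Set.range (Complex.exp ∘ x))) := by
  obtain ⟨hmem, halg⟩ := mem_SF_and_isAlgebraic_exp_of_mem_span x hpi
  refine two_le_trdeg_SF_of_isAlgebraic_pair x algebraicIndependent_pi_exp_pi
    (isAlgebraic_algebraMap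
      (⟨(Real.pi : ℂ), hmem⟩ : ↥(adjoin ℚ (Set.range x ∪ Set.range (Complex.exp ∘ x))))) ?_
  rw [Complex.ofReal_exp]
  exact halg

/-- **Every `ℚ`-plane through `π√3` satisfies the crux** (`π` is a root of `3X² − (π√3)²` over
`ℚ(x, e^x)`, `e^{π√3}` is algebraic over it, `{π, e^{π√3}}` algebraically independent —
Nesterenko at `τ = ρ`); e.g. `x = (iπ, π√3)`, a pair on no plane through `π`.
[cite: NesterenkoPhilippon2001, Ch. 1 §3 Corollary 3.2] -/
theorem schanuelTwo_of_pi_mul_sqrt_three_mem_span (x : Fin 2 → ℂ)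
    (h3 : ((Real.pi * Real.sqrt 3 : ℝ) : ℂ) ∈ Submodule.span ℚ (Set.range x)) :
    (2 : Cardinal) ≤ Algebra.trdeg ℚ
      ↥(IntermediateField.adjoin ℚ (Set.range x ∪ Set.range (Complex.exp ∘ x))) := by
  obtain ⟨hmem, halg⟩ := mem_SF_and_isAlgebraic_exp_of_mem_span x h3
  refine two_le_trdeg_SF_of_isAlgebraic_pair x algebraicIndependent_pi_exp_pi_mul_sqrt_three ?_ ?_
  · -- `π` is a root of `3 X² − (π√3)²`
    refine ⟨Polynomial.C 3 * Polynomial.X ^ 2 - Polynomial.C (⟨_, hmem⟩ ^ 2), ?_, ?_⟩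
    · intro h0
      have := congrArg (fun p => Polynomial.coeff p 2) h0
      simp at this
    · simp only [map_sub, map_mul, map_pow, Polynomial.aeval_X, Polynomial.aeval_C, map_ofNat]
      simp only [IntermediateField.algebraMap_apply]
      push_cast
      rw [mul_pow, ← Complex.ofReal_pow (Real.sqrt 3), Real.sq_sqrt (by norm_num : (0:ℝ) ≤ 3)]
      push_cast
      ring
  · rw [Complex.ofReal_exp]
    exact_mod_cast halg

/-- In particular the pair `(iπ, π√3)` (algebraically dependent, both coordinates transcendental,
on no `ℚ`-plane through `π`) satisfies the crux. [cite: NesterenkoPhilippon2001, Ch. 1 §3 Corollary 3.2] -/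
theorem schanuelTwo_at_piI_pi_mul_sqrt_three :
    (2 : Cardinal) ≤ Algebra.trdeg ℚ
      ↥(IntermediateField.adjoin ℚ
        (Set.range ![(Real.pi : ℂ) * I, ((Real.pi * Real.sqrt 3 : ℝ) : ℂ)] ∪
          Set.range (Complex.exp ∘ ![(Real.pi : ℂ) * I, ((Real.pi * Real.sqrt 3 : ℝ) : ℂ)]))) :=
  schanuelTwo_of_pi_mul_sqrt_three_mem_span _ (Submodule.subset_span ⟨1, by simp⟩)

/-! ### The registered stub -/

/-- **Stub `stub_nesterenkoPlanes` of line `CardA_BW` (crux `SchanuelTwo`, stmt-Schanuel-0069):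
Nesterenko planes.** If the `ℚ`-plane `span_ℚ(x)` contains `π` or `π√3` then
`2 ≤ trdeg_ℚ ℚ(x, e^x)` (Nesterenko 1996 at `τ = i`, resp. `τ = ρ`:
`schanuelTwo_of_pi_mem_span`, `schanuelTwo_of_pi_mul_sqrt_three_mem_span`).
[cite: NesterenkoPhilippon2001, Ch. 3 Corollary 1.2] -/
theorem stub_nesterenkoPlanes :
    ∀ x : Fin 2 → ℂ, ((Real.pi : ℂ) ∈ Submodule.span ℚ (Set.range x) ∨
        ((Real.pi * Real.sqrt 3 : ℝ) : ℂ) ∈ Submodule.span ℚ (Set.range x)) →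
      (2 : Cardinal) ≤ Algebra.trdeg ℚ
        ↥(IntermediateField.adjoin ℚ (Set.range x ∪ Set.range (Complex.exp ∘ x))) := by
  rintro x (hpi | h3)
  · exact schanuelTwo_of_pi_mem_span x hpi
  · exact schanuelTwo_of_pi_mul_sqrt_three_mem_span x h3

end Summit.Schanuel.Schanuel.Theorems

end
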